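import Mathlib
import Summits.Ventures.PercRepro2.Defs
import Summits.Ventures.PercRepro2.Graph
import Summits.Ventures.PercRepro2.Induced
import Summits.Ventures.PercRepro2.VdBKahn
import Summits.Ventures.PercRepro2.ReimerVdBK
import Summits.Ventures.PercRepro2.ReimerVdBKTwisted
import Summits.Ventures.PercRepro2.ReimerVdBKTied
import Summits.Ventures.PercRepro2.ReimerVdBKCoreDown
import Summits.Ventures.PercRepro2.ReimerVdBKDegTwoCalc
import Summits.Ventures.PercRepro2.ReimerVdBKOuter
import Summits.Ventures.PercRepro2.ReimerVdBKPatch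
import Summits.Ventures.PercRepro2.ReimerVdBKOuterStars
import Summits.Ventures.PercRepro2.ReimerVdBKCellEdges
import Summits.Ventures.PercRepro2.ReimerVdBKCell

/-!
# The one coin for an adjacent `X`–`Y` pair at `N = ∅`
(blind cell PercRepro2, mine-c g50; `conjectures/MINE-C.md` §59.0, `proofs/MINEC-CELL.md` — part III;
parts I–II: `ReimerVdBKCellEdges`, `ReimerVdBKCell`)

The ONE-COIN fibre of a colouring `c` at a revealed set `R` (`coinFibre`) is the set of colourings that
agree with `c` on the outer edges of `R` up to ONE joint flip of all the outer stars (the edges inside `R`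
and the edges away from `R` free); the statement **(OUTER-R, ⟨f_R⟩)** (`OneCoin`) is the fibre inequality
between the left and the right instance on every one-coin fibre — finer than (OUTER-R) of `ReimerVdBKOuter`,
which allows each star its own flip.  THEOREM `oneCoin_adjacent_XY`: for a Harris pair `(A, X; B, Y)`
(`X ∩ Y = ∅`) and an ADJACENT pair `u ∈ X`, `v ∈ Y` (some edge has ends `{u, v}`; loops and parallel
edges allowed), `OneCoin … ∅ {u, v}` holds — the census of `MINE-C.md` §58.5 / §59.1 says this is EXACTLY
where the one coin suffices (non-adjacent pairs fail at every `n ≥ 5`).  Proof: the cell theorem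
`count_cell_le` pairs every cell `(d)` of a one-coin fibre with a target cell `coinTarget d` of the same
fibre — if every inner edge is red in `d`, both `u` and `v` are outside the world-1 cluster on the cell
(`v` through a red inner edge), the pair is `X`-like and the target flips both outer stars; otherwise a
blue inner edge puts `u` outside the world-2 cluster with `v`, the pair is `Y`-like and the target is the
cell itself; `coinTarget` is an involution preserving the fibre, so the cell inequalities sum to the fibre
inequality (`count_inter_coinFibre_le`).
-/

namespace Summit.Ventures.PercRepro2
namespace ReimerVdBK
open Classical

variable {V : Type*} {E : Type*} [Fintype E] [DecidableEq E] [Fintype V] [DecidableEq V]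

/-! ## One-coin fibres and the statement -/

section Statement
variable (ends : E → Sym2 V) (s : V)

/-- The one-coin fibre of `c` at `R`: `ω ⊕ c` is constant on ALL the outer edges of `R`. -/
def coinFibre (c : Config E) (R : Finset V) : Set (Config E) := shiftTied c (FE ends R)

omit [Fintype E] [DecidableEq E] [Fintype V] [DecidableEq V] in
/-- Membership in a shifted tied set only depends on the values on `F`. -/
lemma mem_shiftTied_of_agree {c ω ω' : Config E} {F : Finset E} (h : ∀ e ∈ F, ω e = ω' e)
    (hω : ω ∈ shiftTied c F) : ω' ∈ shiftTied c F := by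
  intro e he e' he'
  rw [← h e he, ← h e' he']
  exact hω e he e' he'

omit [Fintype E] [Fintype V] [DecidableEq V] in
/-- Flipping all of `F` preserves the shifted tied set. -/
lemma flipOn_mem_shiftTied_iff (c ω : Config E) (F : Finset E) :
    flipOn F ω ∈ shiftTied c F ↔ ω ∈ shiftTied c F := by
  have key : ∀ ω : Config E, ω ∈ shiftTied c F → flipOn F ω ∈ shiftTied c F := by
    intro ω hω e he e' he'
    have h1 := hω e he e' he'
    rw [flipOn_of_mem _ he, flipOn_of_mem _ he']
    revert h1
    cases ω e <;> cases ω e' <;> cases c e <;> cases c e' <;> decide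
  refine ⟨fun h => ?_, key ω⟩
  have := key _ h
  rwa [flipOn_involutive] at this

variable (A X B Y N R : Finset V)

/-- The core-restricted (at `N`) two-world count on the one-coin fibre of `c` at `R`. -/
noncomputable def coinCount (c : Config E) : ℕ :=
  ∑ ω : Config E, if ω ∈ twoWorld ends s A X B Y ∧ CoreAvoid ends s N ω ∧ ω ∈ coinFibre ends c R then 1 else 0

/-- **(OUTER-R, ⟨f_R⟩), the ONE-COIN statement** for the Harris pair `(A, X; B, Y)`, the unmarked
core-avoided set `N` and the revealed set `R`: on every one-coin fibre of `R` the core-restricted left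
count is at most the core-restricted right count. -/
def OneCoin : Prop :=
  ∀ c : Config E, coinCount ends s A X B Y N R c ≤ coinCount ends s (A ∪ B) ∅ ∅ (X ∪ Y) N R c

/-- With `N = ∅` the coin count is the two-world count on the one-coin fibre. -/
lemma coinCount_empty_N (c : Config E) :
    coinCount ends s A X B Y ∅ R c = count (twoWorld ends s A X B Y ∩ coinFibre ends c R) := by
  unfold coinCount count
  refine Finset.sum_congr rfl fun ω _ => ?_
  have hca : CoreAvoid ends s (∅ : Finset V) ω := fun w hw => absurd hw (Finset.notMem_empty w)
  simp only [hca, true_and, Set.mem_inter_iff]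

end Statement

/-! ## The adjacent `X`–`Y` pair: the target cell and the cell inequality -/

section Pair
variable (ends : E → Sym2 V) (s : V) (A X B Y : Finset V) (u v : V)

/-- The target cell of the cell of `d` for the pair `{u, v}`: both outer stars flipped when every inner
edge is red (open in world 1), the cell itself otherwise. -/
def coinTarget (d : Config E) : Config E :=
  if ∀ e, ends e = s(u, v) → d e = true then flipOn (FE ends {u, v}) d else d

/-- An inner edge of the pair is not an outer edge. -/
lemma inner_not_mem_FE {e : E} (he : ends e = s(u, v)) : e ∉ FE ends {u, v} := by
  intro h
  obtain ⟨w, hw, hwe⟩ := (mem_outerEdges_iff ends _).1 h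
  obtain ⟨x, hx, hxR⟩ := (mem_outerStar_iff ends).1 hwe
  rw [he] at hx
  apply hxR
  rcases Finset.mem_insert.1 hw with rfl | hw
  · rw [Sym2.congr_right] at hx
    rw [← hx]
    exact Finset.mem_insert_of_mem (Finset.mem_singleton_self _)
  · rw [Finset.mem_singleton.1 hw] at hx
    rw [Sym2.eq_swap, Sym2.congr_right] at hx
    rw [← hx]
    exact Finset.mem_insert_self _ _

/-- The flip of the outer edges does not change the inner edges. -/
lemma flipOn_FE_inner (d : Config E) {e : E} (he : ends e = s(u, v)) :
    flipOn (FE ends {u, v}) d e = d e :=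
  flipOn_of_not_mem _ (inner_not_mem_FE ends u v he) d

/-- `coinTarget` is an involution. -/
lemma coinTarget_involutive : Function.Involutive (coinTarget ends u v) := by
  intro d
  unfold coinTarget
  by_cases h : ∀ e, ends e = s(u, v) → d e = true
  · rw [if_pos h]
    have h' : ∀ e, ends e = s(u, v) → flipOn (FE ends {u, v}) d e = true := by
      intro e he
      rw [flipOn_FE_inner ends u v d he]
      exact h e he
    rw [if_pos h', flipOn_involutive]
  · rw [if_neg h, if_neg h]

/-- `coinTarget` preserves every one-coin fibre. -/
lemma coinTarget_mem_coinFibre_iff (c d : Config E) :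
    coinTarget ends u v d ∈ coinFibre ends c {u, v} ↔ d ∈ coinFibre ends c {u, v} := by
  unfold coinTarget
  by_cases h : ∀ e, ends e = s(u, v) → d e = true
  · rw [if_pos h]
    exact flipOn_mem_shiftTied_iff c d _
  · rw [if_neg h]

omit [DecidableEq E] in
/-- Every edge at the pair that is not a loop and misses `v` is an outer-star edge of `u`. -/
lemma mem_outerStar_u_of_not_mem {e : E} (he : e ∈ edgesTouching ends {u, v}) (hnd : ¬ (ends e).IsDiag)
    (hv : v ∉ ends e) : e ∈ outerStar ends {u, v} u := by
  obtain ⟨w, hw, hwe⟩ := (mem_edgesAt_iff ends).1 he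
  have hwu : w = u := by
    rcases Finset.mem_insert.1 hw with rfl | hw
    · rfl
    · exact absurd (Finset.mem_singleton.1 hw ▸ hwe) hv
  subst hwu
  obtain ⟨x, hx⟩ := Sym2.mem_iff_exists.1 hwe
  refine (mem_outerStar_iff ends).2 ⟨x, hx, ?_⟩
  intro hxR
  rcases Finset.mem_insert.1 hxR with rfl | hxv
  · exact hnd (by rw [hx]; exact Sym2.mk_isDiag_iff.2 rfl)
  · rw [Finset.mem_singleton.1 hxv] at hx
    exact hv (by rw [hx]; exact Sym2.mem_mk_right _ _)

/-- **The cell inequality for an adjacent `X`–`Y` pair** (`MINE-C.md` §59.0): the left count on the cell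
of `d` is at most the right count on the cell of `coinTarget d`. -/
theorem count_cell_coin_le (hu : u ∈ X) (hv : v ∈ Y) (hXY : X ∩ Y = ∅) (he : ∃ e, ends e = s(u, v))
    (d : Config E) :
    count (twoWorld ends s A X B Y ∩ onF (edgesTouching ends {u, v}) d) ≤
      count (twoWorld ends s (A ∪ B) ∅ ∅ (X ∪ Y) ∩ onF (edgesTouching ends {u, v}) (coinTarget ends u v d)) := by
  obtain ⟨e₀, he₀⟩ := he
  have huv : u ≠ v := by
    intro h
    subst h
    exact Finset.notMem_empty u (hXY ▸ Finset.mem_inter.2 ⟨hu, hv⟩)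
  have hu_notY : u ∉ Y := fun h => Finset.notMem_empty u (hXY ▸ Finset.mem_inter.2 ⟨hu, h⟩)
  have hv_notX : v ∉ X := fun h => Finset.notMem_empty v (hXY ▸ Finset.mem_inter.2 ⟨h, hv⟩)
  have he₀R : e₀ ∈ edgesTouching ends {u, v} :=
    (mem_edgesAt_iff ends).2 ⟨u, Finset.mem_insert_self _ _, by rw [he₀]; exact Sym2.mem_mk_left _ _⟩
  unfold coinTarget
  by_cases hred : ∀ e, ends e = s(u, v) → d e = true
  · -- every inner edge red: the pair is `X`-like, both outer stars flipped
    rw [if_pos hred]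
    refine count_cell_le ends s A X B Y {u, v} {u, v} {v} ?_ ?_ {u, v} (le_refl _) ?_ d _ ?_ ?_ ?_ ?_ ?_ ?_
    · exact Finset.inter_subset_left
    · intro w hw
      rcases Finset.mem_insert.1 (Finset.mem_inter.1 hw).1 with rfl | hw'
      · exact absurd (Finset.mem_inter.1 hw).2 hu_notY
      · exact hw'
    · exact Finset.sdiff_subset
    · -- `u` avoided by world 1 directly, `v` through the red inner edge
      intro ω' hω' w hw
      obtain ⟨⟨_, hX⟩, _⟩ := hω'
      have hu' : ¬ Conn ends (patch (edgesTouching ends {u, v}) d ω') s u := hX u hu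
      rcases Finset.mem_insert.1 hw with rfl | hw'
      · exact hu'
      · rw [Finset.mem_singleton.1 hw']
        intro hcv
        apply hu'
        refine conn_trans hcv (conn_of_openAdj ⟨e₀, ?_, by rw [he₀, Sym2.eq_swap]⟩)
        rw [patch_of_mem _ he₀R]
        exact hred e₀ he₀
    · intro ω' hω' w hw
      obtain ⟨_, _, hY⟩ := hω'
      rw [Finset.mem_singleton.1 hw]
      exact hY v hv
    · intro e heR _ hnone
      obtain ⟨w, hw, hwe⟩ := (mem_edgesAt_iff ends).1 heR
      exact absurd hwe (hnone w hw)
    · intro e heR hnd hnone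
      have hv' : v ∉ ends e := hnone v (Finset.mem_singleton_self v)
      have hstar := mem_outerStar_u_of_not_mem ends u v heR hnd hv'
      have hFE : e ∈ FE ends {u, v} :=
        (mem_outerEdges_iff ends _).2 ⟨u, Finset.mem_insert_self _ _, hstar⟩
      rw [flipOn_of_mem _ hFE]
    · intro w hw e he
      have hFE : e ∈ FE ends {u, v} := (mem_outerEdges_iff ends _).2 ⟨w, hw, he⟩
      exact flipOn_of_mem _ hFE d
    · intro w hw
      exact absurd (Finset.mem_sdiff.1 hw).1 (Finset.mem_sdiff.1 hw).2
  · -- some inner edge blue: the pair is `Y`-like, the cell is its own target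
    rw [if_neg hred]
    simp only [not_forall, Bool.not_eq_true] at hred
    obtain ⟨e₁, he₁, he₁d⟩ := hred
    have he₁R : e₁ ∈ edgesTouching ends {u, v} :=
      (mem_edgesAt_iff ends).2 ⟨u, Finset.mem_insert_self _ _, by rw [he₁]; exact Sym2.mem_mk_left _ _⟩
    refine count_cell_le ends s A X B Y {u, v} {u} {u, v} ?_ ?_ ∅ (Finset.empty_subset _) ?_ d d ?_ ?_ ?_ ?_ ?_ ?_
    · intro w hw
      rcases Finset.mem_insert.1 (Finset.mem_inter.1 hw).1 with rfl | hw'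
      · exact Finset.mem_singleton_self _
      · rw [Finset.mem_singleton.1 hw'] at hw
        exact absurd (Finset.mem_inter.1 hw).2 hv_notX
    · exact Finset.inter_subset_left
    · intro w hw
      exact absurd (Finset.mem_sdiff.1 hw).1 (Finset.mem_sdiff.1 hw).2
    · intro ω' hω' w hw
      obtain ⟨⟨_, hX⟩, _⟩ := hω'
      rw [Finset.mem_singleton.1 hw]
      exact hX u hu
    · -- `v` avoided by world 2 directly, `u` through the blue inner edge
      intro ω' hω' w hw
      obtain ⟨_, _, hY⟩ := hω'
      have hv' : ¬ Conn ends (compl (patch (edgesTouching ends {u, v}) d ω')) s v := hY v hv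
      rcases Finset.mem_insert.1 hw with rfl | hw'
      · intro hcu
        apply hv'
        refine conn_trans hcu (conn_of_openAdj ⟨e₁, ?_, he₁⟩)
        simp only [compl]
        rw [patch_of_mem _ he₁R, he₁d]
        rfl
      · rw [Finset.mem_singleton.1 hw']
        exact hv'
    · intro e _ _ _
      exact le_refl _
    · intro e heR _ hnone
      obtain ⟨w, hw, hwe⟩ := (mem_edgesAt_iff ends).1 heR
      exact absurd hwe (hnone w hw)
    · intro w hw
      exact absurd hw (Finset.notMem_empty w)
    · intro w _ e _
      rfl

end Pair

/-! ## Summation over the cells of a one-coin fibre -/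

section Main
variable (ends : E → Sym2 V) (s : V) (A X B Y : Finset V) (u v : V)

omit [Fintype V] in
/-- The cube of free edges of a cell is nonempty. -/
lemma count_univ_cell_pos (R : Finset V) :
    0 < count (Set.univ : Set (Config {e : E // e ∉ edgesTouching ends R})) := by
  unfold count
  exact Finset.sum_pos' (fun ω _ => by split_ifs <;> omega)
    ⟨fun _ => false, Finset.mem_univ _, by simp⟩

/-- **The one-coin fibre inequality for an adjacent `X`–`Y` pair at `N = ∅`.** -/
theorem count_inter_coinFibre_le (hu : u ∈ X) (hv : v ∈ Y) (hXY : X ∩ Y = ∅) (he : ∃ e, ends e = s(u, v))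
    (c : Config E) :
    count (twoWorld ends s A X B Y ∩ coinFibre ends c {u, v}) ≤
      count (twoWorld ends s (A ∪ B) ∅ ∅ (X ∪ Y) ∩ coinFibre ends c {u, v}) := by
  set CE := edgesTouching ends {u, v} with hCE
  have hFib : ∀ ω ω' : Config E, (∀ e ∈ CE, ω e = ω' e) → ω ∈ coinFibre ends c {u, v} →
      ω' ∈ coinFibre ends c {u, v} :=
    fun ω ω' h hω => mem_shiftTied_of_agree (fun e he => h e (FE_subset_edgesAt ends _ he)) hω
  have h1 := mul_count_inter_eq_sum_onF CE (twoWorld ends s A X B Y) (coinFibre ends c {u, v}) hFib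
  have h2 := mul_count_inter_eq_sum_onF CE (twoWorld ends s (A ∪ B) ∅ ∅ (X ∪ Y))
    (coinFibre ends c {u, v}) hFib
  refine Nat.le_of_mul_le_mul_left ?_ (count_univ_cell_pos ends {u, v})
  rw [h1, h2]
  have h3 : ∀ d : Config E,
      (if d ∈ coinFibre ends c {u, v} then count (twoWorld ends s A X B Y ∩ onF CE d) else 0) ≤
        (if d ∈ coinFibre ends c {u, v} then
          count (twoWorld ends s (A ∪ B) ∅ ∅ (X ∪ Y) ∩ onF CE (coinTarget ends u v d)) else 0) := by
    intro d
    split_ifs with hd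
    · exact count_cell_coin_le ends s A X B Y u v hu hv hXY he d
    · exact le_refl 0
  calc ∑ d : Config E, (if d ∈ coinFibre ends c {u, v} then count (twoWorld ends s A X B Y ∩ onF CE d) else 0)
      ≤ ∑ d : Config E, (if d ∈ coinFibre ends c {u, v} then
          count (twoWorld ends s (A ∪ B) ∅ ∅ (X ∪ Y) ∩ onF CE (coinTarget ends u v d)) else 0) :=
        Finset.sum_le_sum fun d _ => h3 d
    _ = ∑ d : Config E, (if coinTarget ends u v d ∈ coinFibre ends c {u, v} then
          count (twoWorld ends s (A ∪ B) ∅ ∅ (X ∪ Y) ∩ onF CE (coinTarget ends u v d)) else 0) := by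
        refine Finset.sum_congr rfl fun d _ => ?_
        rw [coinTarget_mem_coinFibre_iff ends u v c d]
    _ = ∑ d : Config E, (if d ∈ coinFibre ends c {u, v} then
          count (twoWorld ends s (A ∪ B) ∅ ∅ (X ∪ Y) ∩ onF CE d) else 0) :=
        Equiv.sum_comp (Function.Involutive.toPerm _ (coinTarget_involutive ends u v))
          (fun d => if d ∈ coinFibre ends c {u, v} then
            count (twoWorld ends s (A ∪ B) ∅ ∅ (X ∪ Y) ∩ onF CE d) else 0)

/-- **THE ONE COIN FOR AN ADJACENT `X`–`Y` PAIR AT `N = ∅`** (`MINE-C.md` §59.0): for a Harris pair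
`(A, X; B, Y)` (`X ∩ Y = ∅`), `u ∈ X`, `v ∈ Y` joined by an edge, the one-coin statement
(OUTER-{u, v}, ⟨f_u f_v⟩) holds with `N = ∅` — on every one-coin fibre the two-world count of the left
instance is at most that of the right instance.  Loops and parallel edges are allowed; without the edge
`u v` the statement is false (`MINE-C.md` §58.5). -/
theorem oneCoin_adjacent_XY (hu : u ∈ X) (hv : v ∈ Y) (hXY : X ∩ Y = ∅) (he : ∃ e, ends e = s(u, v)) :
    OneCoin ends s A X B Y ∅ {u, v} := by
  intro c
  rw [coinCount_empty_N, coinCount_empty_N]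
  exact count_inter_coinFibre_le ends s A X B Y u v hu hv hXY he c

end Main

end ReimerVdBK
end Summit.Ventures.PercRepro2
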